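import Mathlib
import Summits.ResolutionOfSingularities.ResolutionOfSingularities.Theorems.WeightedInvariantLocalWeightedDropNewtonSetChartLaws
import HarnessLib

/-!
# `WeightedInvariant.LocalWeightedDrop`, line `hasse-ridge-face-selection`: WEIGHTED ORDERS of a point set `N ⊂ ℕ²`
# under the chart maps at a general scale `c` — the `(1, n)`-order of the `u₁`-chart image is the `(1, n+1)`-order of
# the source shifted by `c` (and the letter swap for the `u₂`-chart)

Crux item stmt-ResolutionOfSingularities-8899 `LocalWeightedDrop` (route `ResolutionOfSingularities/WeightedInvariant`), serving
the door `WeightedConstruction` stmt-ResolutionOfSingularities-0571.  [OURS · L1 W4.3, chain w43, support typer res-L1-type-o7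
(seat res-D-pv-023): companion of `…NewtonSetChartLaws` (p499926) for the weighted flags `V(y, x₂ + λ x₁ⁿ)`, weights `(1, n)`, of
the wild measures (Perlega 2017 Prop. 9.1.1 / 9.1.4; consumer res-D-pv-056 AS stub-5, S3ρD case D-c «(d, n) ↦ (d, n − 1) under
the axis step»: «under the AXIS step psi L: ω_n-order − L = ω_{n−1}-order of the image»); `deltaL_image_psiC_add` is the case
`n = 1`.  Pure combinatorics on `N ⊂ ℕ²`; NOT a statement of any manuscript.]

* `sInf_weight_image_psiC_add` — `min_{Q ∈ psi c '' N} (Q₀ + n Q₁) + c = min_{P ∈ N} (P₀ + (n + 1) P₁)`;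
* `sInf_weight_image_phiEC_add` — `min_{Q ∈ phiE c '' N} (n Q₀ + Q₁) + c = min_{P ∈ N} ((n + 1) P₀ + P₁)`;
* (rev 2) `mem_weightLine_image_psiC_iff` / `mem_weightLine_image_phiEC_iff` — the weighted initial lines correspond point by point
  (heights kept): «the initial-line heights agree» of stub-5's D-c.
[folklore]
-/

set_option linter.dupNamespace false -- mandated namespace of this single-conjunct summit

namespace Summit.ResolutionOfSingularities.ResolutionOfSingularities.Theorems

namespace MonicDescent

variable {N : Set (Fin 2 →₀ ℕ)} {c : ℕ}


/-- `min_{Q ∈ psi c '' N} (Q₀ + n Q₁) + c = min_{P ∈ N} (P₀ + (n + 1) P₁)` (order `≥ c` on `N`). -/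
theorem sInf_weight_image_psiC_add (n : ℕ) (hNc : ∀ P ∈ N, c ≤ P 0 + P 1) (hN : N.Nonempty) :
    sInf ((fun Q : Fin 2 →₀ ℕ => Q 0 + n * Q 1) '' (psi c '' N)) + c =
      sInf ((fun P : Fin 2 →₀ ℕ => P 0 + (n + 1) * P 1) '' N) := by
  apply le_antisymm
  · obtain ⟨P, hP, hPw⟩ := Nat.sInf_mem (hN.image (fun P : Fin 2 →₀ ℕ => P 0 + (n + 1) * P 1))
    have hPw' : P 0 + (n + 1) * P 1 = sInf ((fun P : Fin 2 →₀ ℕ => P 0 + (n + 1) * P 1) '' N) := hPw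
    have h : sInf ((fun Q : Fin 2 →₀ ℕ => Q 0 + n * Q 1) '' (psi c '' N)) ≤ (psi c P) 0 + n * (psi c P) 1 :=
      Nat.sInf_le ⟨psi c P, ⟨P, hP, rfl⟩, rfl⟩
    rw [psi_apply_zero, psi_apply_one] at h
    have := hNc P hP
    rw [← hPw']
    have hring : P 0 + (n + 1) * P 1 = (P 0 + P 1 - c + n * P 1) + c := by
      rw [Nat.add_mul, one_mul]; omega
    omega
  · obtain ⟨Q, ⟨P, hP, rfl⟩, hQw⟩ :=
      Nat.sInf_mem ((hN.image (psi c)).image (fun Q : Fin 2 →₀ ℕ => Q 0 + n * Q 1))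
    have hQw' : (psi c P) 0 + n * (psi c P) 1 = sInf ((fun Q : Fin 2 →₀ ℕ => Q 0 + n * Q 1) '' (psi c '' N)) := hQw
    rw [← hQw', psi_apply_zero, psi_apply_one]
    have h : sInf ((fun P : Fin 2 →₀ ℕ => P 0 + (n + 1) * P 1) '' N) ≤ P 0 + (n + 1) * P 1 := Nat.sInf_le ⟨P, hP, rfl⟩
    have := hNc P hP
    have hring : P 0 + (n + 1) * P 1 = (P 0 + P 1 - c + n * P 1) + c := by
      rw [Nat.add_mul, one_mul]; omega
    omega

/-- The letter swap: `min_{Q ∈ phiE c '' N} (n Q₀ + Q₁) + c = min_{P ∈ N} ((n + 1) P₀ + P₁)`. -/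
theorem sInf_weight_image_phiEC_add (n : ℕ) (hNc : ∀ P ∈ N, c ≤ P 0 + P 1) (hN : N.Nonempty) :
    sInf ((fun Q : Fin 2 →₀ ℕ => n * Q 0 + Q 1) '' (phiE c '' N)) + c =
      sInf ((fun P : Fin 2 →₀ ℕ => (n + 1) * P 0 + P 1) '' N) := by
  apply le_antisymm
  · obtain ⟨P, hP, hPw⟩ := Nat.sInf_mem (hN.image (fun P : Fin 2 →₀ ℕ => (n + 1) * P 0 + P 1))
    have hPw' : (n + 1) * P 0 + P 1 = sInf ((fun P : Fin 2 →₀ ℕ => (n + 1) * P 0 + P 1) '' N) := hPw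
    have h : sInf ((fun Q : Fin 2 →₀ ℕ => n * Q 0 + Q 1) '' (phiE c '' N)) ≤ n * (phiE c P) 0 + (phiE c P) 1 :=
      Nat.sInf_le ⟨phiE c P, ⟨P, hP, rfl⟩, rfl⟩
    rw [phiE_apply_zero, phiE_apply_one] at h
    have := hNc P hP
    rw [← hPw']
    have hring : (n + 1) * P 0 + P 1 = (n * P 0 + (P 0 + P 1 - c)) + c := by
      rw [Nat.add_mul, one_mul]; omega
    omega
  · obtain ⟨Q, ⟨P, hP, rfl⟩, hQw⟩ :=
      Nat.sInf_mem ((hN.image (phiE c)).image (fun Q : Fin 2 →₀ ℕ => n * Q 0 + Q 1))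
    have hQw' : n * (phiE c P) 0 + (phiE c P) 1 = sInf ((fun Q : Fin 2 →₀ ℕ => n * Q 0 + Q 1) '' (phiE c '' N)) := hQw
    rw [← hQw', phiE_apply_zero, phiE_apply_one]
    have h : sInf ((fun P : Fin 2 →₀ ℕ => (n + 1) * P 0 + P 1) '' N) ≤ (n + 1) * P 0 + P 1 := Nat.sInf_le ⟨P, hP, rfl⟩
    have := hNc P hP
    have hring : (n + 1) * P 0 + P 1 = (n * P 0 + (P 0 + P 1 - c)) + c := by
      rw [Nat.add_mul, one_mul]; omega
    omega


/-! ## (rev 2) The weighted initial lines correspond point by point (heights `Q₁ = P₁` are kept) -/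

/-- A point of the image lies on the `(1, n)`-line of level `m` iff it is `psi c P` for a point `P ∈ N` on the
`(1, n+1)`-line of level `m + c`; in particular the HEIGHTS (`P₁`-coordinates, `psi_apply_one`) on the two initial
lines correspond. [folklore] -/
theorem mem_weightLine_image_psiC_iff (n m : ℕ) (hNc : ∀ P ∈ N, c ≤ P 0 + P 1) (Q : Fin 2 →₀ ℕ) :
    (Q ∈ psi c '' N ∧ Q 0 + n * Q 1 = m) ↔ ∃ P ∈ N, P 0 + (n + 1) * P 1 = m + c ∧ Q = psi c P := by
  constructor
  · rintro ⟨⟨P, hP, rfl⟩, hm⟩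
    rw [psi_apply_zero, psi_apply_one] at hm
    have := hNc P hP
    refine ⟨P, hP, ?_, rfl⟩
    rw [Nat.add_mul, one_mul]
    omega
  · rintro ⟨P, hP, hm, rfl⟩
    refine ⟨⟨P, hP, rfl⟩, ?_⟩
    rw [psi_apply_zero, psi_apply_one]
    rw [Nat.add_mul, one_mul] at hm
    have := hNc P hP
    omega

/-- The letter swap: a point of `phiE c '' N` lies on the `(n, 1)`-line of level `m` iff it is `phiE c P` for `P ∈ N`
on the `(n+1, 1)`-line of level `m + c` (the `P₀`-coordinates correspond, `phiE_apply_zero`). [folklore] -/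
theorem mem_weightLine_image_phiEC_iff (n m : ℕ) (hNc : ∀ P ∈ N, c ≤ P 0 + P 1) (Q : Fin 2 →₀ ℕ) :
    (Q ∈ phiE c '' N ∧ n * Q 0 + Q 1 = m) ↔ ∃ P ∈ N, (n + 1) * P 0 + P 1 = m + c ∧ Q = phiE c P := by
  constructor
  · rintro ⟨⟨P, hP, rfl⟩, hm⟩
    rw [phiE_apply_zero, phiE_apply_one] at hm
    have := hNc P hP
    refine ⟨P, hP, ?_, rfl⟩
    rw [Nat.add_mul, one_mul]
    omega
  · rintro ⟨P, hP, hm, rfl⟩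
    refine ⟨⟨P, hP, rfl⟩, ?_⟩
    rw [phiE_apply_zero, phiE_apply_one]
    rw [Nat.add_mul, one_mul] at hm
    have := hNc P hP
    omega

end MonicDescent

end Summit.ResolutionOfSingularities.ResolutionOfSingularities.Theorems
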